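import Mathlib
import HarnessLib

/-!
# LatticeQCDFlow / Scaling — the acceptance volume FLOOR for `m` INDEPENDENT BLOCKS on a GENERAL
# space (`Measure.pi`): `∏ᵢ acc(pᵢ, qᵢ) ≤ acc(⊗ᵢ pᵢ, ⊗ᵢ qᵢ)`, and `ESS(⊗) = ∏ᵢ ESSᵢ` exactly

HONEST FRAMING: exact (Metropolis-corrected) sampling algorithms for lattice gauge theory;
figures of merit are autocorrelation/cost numbers at stated couplings and volumes; no
continuum-physics claim.

Venture `LatticeQCDFlow` (cell pub-lqcd), topic `Scaling`; FANOUT row 3 (`s0-u1-a`, S0-B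
implementation A, GEN-12).  NEW WORK of the cell (elementary; Fubini over a finite product of
measure spaces), the `m`-block measure-theoretic form of row 3's `Scaling/AcceptanceVolumeSandwich`
(finite blocks, `Theory2.blockProd`) and `Scaling/AcceptanceVolumeSandwichIntegral` (two blocks on a
general space); the CEILING half is the companion file `Scaling/AcceptanceVolumeCeilingPi`.
SETTING: a finite index type `ι` of blocks (lattice sites, cells, time-slices…), block state spaces
`X i` with σ-finite reference measures `μ i`, block TARGET densities `p i ≥ 0` and block MODEL
densities `q i ≥ 0` (measurable, integrable), the factorised target `P(x) = ∏ᵢ pᵢ(xᵢ)` and model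
`Q(x) = ∏ᵢ qᵢ(xᵢ)` on the product space `Π i, X i` with reference measure `Measure.pi μ`, and the
equilibrium acceptance of the flow (independence Metropolis) sampler written on densities,
`acc(p, q) = ∫∫ min(p(a) q(b), p(b) q(a)) dμ(a) dμ(b)` (the form of rows 3 / 4's general-space files).
NO definition is introduced; no normalisation, no positivity of the model and no weight ceiling is
assumed in this file.

* `prod_min_le_min_prod_of_nonneg` — `∏ᵢ min(aᵢ, bᵢ) ≤ min(∏ᵢ aᵢ, ∏ᵢ bᵢ)` for nonnegative reals;
  `min_le_ite_add_ite`, `ite_add_ite_eq_min` — the selector split of a minimum (used by the ceiling);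
* `piDensity_facts` — `P ≥ 0` is measurable, integrable for `Measure.pi μ`, `∫ P = ∏ᵢ ∫ pᵢ`
  (Mathlib's `integral_fintype_prod_eq_prod`, `Integrable.fintype_prod_dep`);
* `integral_mul_prod_erase_pi` — one-coordinate Fubini:
  `∫ ψ(xⱼ) ∏_{i ≠ j} φᵢ(xᵢ) d(⊗μ) = (∫ ψ dμⱼ) · ∏_{i ≠ j} ∫ φᵢ dμᵢ`;
* **`prod_meanAccept_le_meanAccept_pi`** — THE FLOOR `∏ᵢ acc(pᵢ, qᵢ) ≤ acc(P, Q)` (only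
  nonnegativity and integrability are used: the product of the block pair-minima is below the
  pair-minimum of the products, then Fubini twice);
* `integral_sq_div_pi`, **`essFrac_pi`** — the companion EXACT laws of the second weight moment and
  of the effective sample size, `∫ P²/Q d(⊗μ) = ∏ᵢ ∫ pᵢ²/qᵢ dμᵢ` and
  `(∫P)²/∫P²/Q = ∏ᵢ (∫pᵢ)²/∫pᵢ²/qᵢ` (row 31's finite `Theory2.essFrac_blockProd` on a general space);
* `pow_meanAccept_le_meanAccept_pi_const`, `essFrac_pi_const` — identical blocks:
  `acc₁^m ≤ acc_m`, `ESS_m = ESS₁^m` (`m = card ι`).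

Reading (value-free): for a flow that factorises over `m` independent blocks of a general
configuration space, the equilibrium acceptance is at least the product of the block acceptances
while the effective sample size is exactly the product of the block values — on continuous state
spaces exactly as on finite ones.  NOT CLAIMED: any acceptance or ESS value of ours; nothing
re-scored.
-/

namespace Summit.Ventures.LatticeQCDFlow.Theory2

open MeasureTheory Finset

/-! ## Algebra: products of minima -/

/-- `∏ᵢ min(aᵢ, bᵢ) ≤ min(∏ᵢ aᵢ, ∏ᵢ bᵢ)` for nonnegative real families. [folklore] -/
theorem prod_min_le_min_prod_of_nonneg {ι : Type*} (s : Finset ι) (a b : ι → ℝ)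
    (ha : ∀ i ∈ s, 0 ≤ a i) (hb : ∀ i ∈ s, 0 ≤ b i) :
    ∏ i ∈ s, min (a i) (b i) ≤ min (∏ i ∈ s, a i) (∏ i ∈ s, b i) :=
  le_min (prod_le_prod (fun i hi => le_min (ha i hi) (hb i hi)) fun _ _ => min_le_left _ _)
    (prod_le_prod (fun i hi => le_min (ha i hi) (hb i hi)) fun _ _ => min_le_right _ _)

/-- The selector split of a minimum: `min(F, G) ≤ 1[c]·F + 1[¬c]·G`. [folklore] -/
theorem min_le_ite_add_ite (F G : ℝ) (c : Prop) [Decidable c] :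
    min F G ≤ (if c then F else 0) + (if c then 0 else G) := by
  by_cases hc : c
  · rw [if_pos hc, if_pos hc, add_zero]; exact min_le_left _ _
  · rw [if_neg hc, if_neg hc, zero_add]; exact min_le_right _ _

/-- The selector split is exact on the deciding pair: `1[F ≤ G]·F + 1[¬(F ≤ G)]·G = min(F, G)`.
[folklore] -/
theorem ite_add_ite_eq_min (F G : ℝ) :
    (if F ≤ G then F else 0) + (if F ≤ G then 0 else G) = min F G := by
  by_cases hc : F ≤ G
  · rw [if_pos hc, if_pos hc, add_zero, min_eq_left hc]
  · rw [if_neg hc, if_neg hc, zero_add, min_eq_right (le_of_lt (not_le.mp hc))]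

variable {ι : Type*} [Fintype ι] {X : ι → Type*} [∀ i, MeasurableSpace (X i)]
  {μ : (i : ι) → Measure (X i)} [∀ i, SigmaFinite (μ i)]

/-! ## Product densities on `Π i, X i` -/

/-- **Bookkeeping for a product density.**  For nonnegative measurable integrable block densities
`pᵢ`, the product `P(x) = ∏ᵢ pᵢ(xᵢ)` is nonnegative, measurable, integrable w.r.t. `Measure.pi μ`,
and `∫ P d(⊗μ) = ∏ᵢ ∫ pᵢ dμᵢ`. [folklore] -/
theorem piDensity_facts {p : (i : ι) → X i → ℝ} (hp0 : ∀ i a, 0 ≤ p i a)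
    (hpm : ∀ i, Measurable (p i)) (hpi : ∀ i, Integrable (p i) (μ i)) :
    (∀ x : (i : ι) → X i, 0 ≤ ∏ i, p i (x i)) ∧
    Measurable (fun x : (i : ι) → X i => ∏ i, p i (x i)) ∧
    Integrable (fun x : (i : ι) → X i => ∏ i, p i (x i)) (Measure.pi μ) ∧
    ∫ x, ∏ i, p i (x i) ∂(Measure.pi μ) = ∏ i, ∫ a, p i a ∂(μ i) :=
  ⟨fun x => prod_nonneg fun i _ => hp0 i (x i),
    Finset.measurable_prod _ fun i _ => (hpm i).comp (measurable_pi_apply i),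
    Integrable.fintype_prod_dep hpi, integral_fintype_prod_eq_prod _⟩

/-- **One-coordinate Fubini over `Measure.pi`.**  For any block `j`, any `ψ` on `X j` and any
family `φᵢ`: `∫ ψ(xⱼ)·∏_{i ≠ j} φᵢ(xᵢ) d(⊗μ) = (∫ ψ dμⱼ)·∏_{i ≠ j} ∫ φᵢ dμᵢ` (both sides are the
`Measure.pi` integral of the product of the updated family `Function.update φ j ψ`). [folklore] -/
theorem integral_mul_prod_erase_pi [DecidableEq ι] (j : ι) (ψ : X j → ℝ)
    (φ : (i : ι) → X i → ℝ) :
    ∫ x, ψ (x j) * ∏ i ∈ univ.erase j, φ i (x i) ∂(Measure.pi μ)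
      = (∫ a, ψ a ∂(μ j)) * ∏ i ∈ univ.erase j, ∫ a, φ i a ∂(μ i) := by
  have key : ∀ x : (i : ι) → X i,
      ψ (x j) * ∏ i ∈ univ.erase j, φ i (x i) = ∏ i, Function.update φ j ψ i (x i) := by
    intro x
    rw [← mul_prod_erase univ (fun i => Function.update φ j ψ i (x i)) (mem_univ j),
      Function.update_self]
    congr 1
    exact prod_congr rfl fun i hi => by rw [Function.update_of_ne (ne_of_mem_erase hi)]
  simp_rw [key, integral_fintype_prod_eq_prod]
  rw [← mul_prod_erase univ _ (mem_univ j), Function.update_self]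
  congr 1
  exact prod_congr rfl fun i hi => by rw [Function.update_of_ne (ne_of_mem_erase hi)]

/-! ## The floor: acceptance is super-multiplicative over independent blocks -/

/-- **ACCEPTANCE IS SUPER-MULTIPLICATIVE OVER `m` INDEPENDENT BLOCKS (general space).**  For
nonnegative measurable integrable block targets `pᵢ` and block models `qᵢ` (no normalisation, no
positivity, no weight ceiling needed):
`∏ᵢ ∫∫ min(pᵢ(a)qᵢ(b), pᵢ(b)qᵢ(a)) dμᵢ dμᵢ ≤ ∫∫ min(P(x)Q(x′), P(x′)Q(x)) d(⊗μ) d(⊗μ)`,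
i.e. `∏ᵢ acc(pᵢ, qᵢ) ≤ acc(⊗pᵢ, ⊗qᵢ)`. [ours] -/
theorem prod_meanAccept_le_meanAccept_pi {p q : (i : ι) → X i → ℝ} (hp0 : ∀ i a, 0 ≤ p i a)
    (hpm : ∀ i, Measurable (p i)) (hpi : ∀ i, Integrable (p i) (μ i)) (hq0 : ∀ i a, 0 ≤ q i a)
    (hqm : ∀ i, Measurable (q i)) (hqi : ∀ i, Integrable (q i) (μ i)) :
    ∏ i, (∫ a, ∫ b, min (p i a * q i b) (p i b * q i a) ∂(μ i) ∂(μ i))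
      ≤ ∫ x, ∫ x', min ((∏ i, p i (x i)) * ∏ i, q i (x' i)) ((∏ i, p i (x' i)) * ∏ i, q i (x i))
          ∂(Measure.pi μ) ∂(Measure.pi μ) := by
  obtain ⟨hP0, hPm, hPi, -⟩ := piDensity_facts (μ := μ) hp0 hpm hpi
  obtain ⟨hQ0, hQm, hQi, -⟩ := piDensity_facts (μ := μ) hq0 hqm hqi
  -- the pair kernel on the product of the two product spaces
  have hKm : Measurable (fun e : ((i : ι) → X i) × ((i : ι) → X i) =>
      min ((∏ i, p i (e.1 i)) * ∏ i, q i (e.2 i)) ((∏ i, p i (e.2 i)) * ∏ i, q i (e.1 i))) :=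
    ((hPm.comp measurable_fst).mul (hQm.comp measurable_snd)).min
      ((hPm.comp measurable_snd).mul (hQm.comp measurable_fst))
  have hKnn : ∀ x x' : (i : ι) → X i,
      0 ≤ min ((∏ i, p i (x i)) * ∏ i, q i (x' i)) ((∏ i, p i (x' i)) * ∏ i, q i (x i)) :=
    fun x x' => le_min (mul_nonneg (hP0 _) (hQ0 _)) (mul_nonneg (hP0 _) (hQ0 _))
  have hKi : Integrable (fun e : ((i : ι) → X i) × ((i : ι) → X i) =>
      min ((∏ i, p i (e.1 i)) * ∏ i, q i (e.2 i)) ((∏ i, p i (e.2 i)) * ∏ i, q i (e.1 i)))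
      ((Measure.pi μ).prod (Measure.pi μ)) := by
    refine Integrable.mono' (hPi.mul_prod hQi) hKm.aestronglyMeasurable
      (Filter.Eventually.of_forall fun e => ?_)
    rw [Real.norm_of_nonneg (hKnn _ _)]
    exact min_le_left _ _
  -- step 1: for every `x`, the inner integral dominates the product of the block inner integrals
  have step1 : ∀ x : (i : ι) → X i,
      ∏ i, (∫ b, min (p i (x i) * q i b) (p i b * q i (x i)) ∂(μ i))
        ≤ ∫ x', min ((∏ i, p i (x i)) * ∏ i, q i (x' i)) ((∏ i, p i (x' i)) * ∏ i, q i (x i))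
            ∂(Measure.pi μ) := by
    intro x
    rw [← integral_fintype_prod_eq_prod (fun i b => min (p i (x i) * q i b) (p i b * q i (x i)))]
    have hKxi : Integrable (fun x' : (i : ι) → X i =>
        min ((∏ i, p i (x i)) * ∏ i, q i (x' i)) ((∏ i, p i (x' i)) * ∏ i, q i (x i)))
        (Measure.pi μ) := by
      refine Integrable.mono' (hQi.const_mul (∏ i, p i (x i)))
        (hKm.comp measurable_prodMk_left).aestronglyMeasurable
        (Filter.Eventually.of_forall fun x' => ?_)
      rw [Real.norm_of_nonneg (hKnn _ _)]
      exact min_le_left _ _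
    refine integral_mono_of_nonneg (Filter.Eventually.of_forall fun x' => prod_nonneg fun i _ =>
        le_min (mul_nonneg (hp0 _ _) (hq0 _ _)) (mul_nonneg (hp0 _ _) (hq0 _ _))) hKxi
      (Filter.Eventually.of_forall fun x' => ?_)
    calc ∏ i, min (p i (x i) * q i (x' i)) (p i (x' i) * q i (x i))
        ≤ min (∏ i, p i (x i) * q i (x' i)) (∏ i, p i (x' i) * q i (x i)) :=
          prod_min_le_min_prod_of_nonneg _ _ _ (fun i _ => mul_nonneg (hp0 _ _) (hq0 _ _))
            (fun i _ => mul_nonneg (hp0 _ _) (hq0 _ _))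
      _ = min ((∏ i, p i (x i)) * ∏ i, q i (x' i)) ((∏ i, p i (x' i)) * ∏ i, q i (x i)) := by
          rw [prod_mul_distrib, prod_mul_distrib]
  -- step 2: integrate over `x`
  calc ∏ i, (∫ a, ∫ b, min (p i a * q i b) (p i b * q i a) ∂(μ i) ∂(μ i))
      = ∫ x, ∏ i, (∫ b, min (p i (x i) * q i b) (p i b * q i (x i)) ∂(μ i)) ∂(Measure.pi μ) :=
        (integral_fintype_prod_eq_prod
          (fun i a => ∫ b, min (p i a * q i b) (p i b * q i a) ∂(μ i))).symm
    _ ≤ ∫ x, ∫ x', min ((∏ i, p i (x i)) * ∏ i, q i (x' i)) ((∏ i, p i (x' i)) * ∏ i, q i (x i))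
          ∂(Measure.pi μ) ∂(Measure.pi μ) :=
        integral_mono_of_nonneg (Filter.Eventually.of_forall fun x => prod_nonneg fun i _ =>
            integral_nonneg fun b => le_min (mul_nonneg (hp0 _ _) (hq0 _ _))
              (mul_nonneg (hp0 _ _) (hq0 _ _)))
          hKi.integral_prod_left (Filter.Eventually.of_forall step1)

/-! ## The companion exact laws: second weight moment and effective sample size multiply -/

/-- **The second weight moment multiplies over independent blocks (general space)**:
`∫ P²/Q d(⊗μ) = ∏ᵢ ∫ pᵢ²/qᵢ dμᵢ` (`1/ESS` of the factorised flow is the product of the block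
values; no hypothesis at all — both sides are Bochner integrals). [ours] -/
theorem integral_sq_div_pi (p q : (i : ι) → X i → ℝ) :
    ∫ x, (∏ i, p i (x i)) ^ 2 / ∏ i, q i (x i) ∂(Measure.pi μ)
      = ∏ i, ∫ a, p i a ^ 2 / q i a ∂(μ i) := by
  have h : ∀ x : (i : ι) → X i,
      (∏ i, p i (x i)) ^ 2 / ∏ i, q i (x i) = ∏ i, (p i (x i) ^ 2 / q i (x i)) := by
    intro x
    rw [prod_div_distrib, prod_pow]
  simp_rw [h]
  exact integral_fintype_prod_eq_prod (μ := μ) fun i a => p i a ^ 2 / q i a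

/-- **THE EFFECTIVE SAMPLE SIZE IS MULTIPLICATIVE OVER INDEPENDENT BLOCKS (general space)**:
`(∫ P)²/(∫ P²/Q) = ∏ᵢ (∫ pᵢ)²/(∫ pᵢ²/qᵢ)` — the Kish fraction `ESS/N = (E_Q w)²/E_Q w²` of the
factorised flow, written on densities (`E_Q w = ∫ P`, `E_Q w² = ∫ P²/Q`), is the product of the
block fractions; the measure-theoretic twin of row 31's `Theory2.essFrac_blockProd`. [ours] -/
theorem essFrac_pi (p q : (i : ι) → X i → ℝ) :
    (∫ x, ∏ i, p i (x i) ∂(Measure.pi μ)) ^ 2 / ∫ x, (∏ i, p i (x i)) ^ 2 / ∏ i, q i (x i)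
        ∂(Measure.pi μ)
      = ∏ i, ((∫ a, p i a ∂(μ i)) ^ 2 / ∫ a, p i a ^ 2 / q i a ∂(μ i)) := by
  rw [integral_fintype_prod_eq_prod, integral_sq_div_pi, prod_div_distrib, prod_pow]

/-! ## Identical blocks: `acc₁^m ≤ acc_m`, `ESS_m = ESS₁^m` -/

section Const

variable {Y : Type*} [MeasurableSpace Y] {ν : Measure Y} [SigmaFinite ν]

/-- **Identical blocks, floor**: `acc(p, q)^m ≤ acc(p^{⊗m}, q^{⊗m})`, `m = card ι`. [ours] -/
theorem pow_meanAccept_le_meanAccept_pi_const {p q : Y → ℝ} (hp0 : ∀ a, 0 ≤ p a)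
    (hpm : Measurable p) (hpi : Integrable p ν) (hq0 : ∀ a, 0 ≤ q a) (hqm : Measurable q)
    (hqi : Integrable q ν) :
    (∫ a, ∫ b, min (p a * q b) (p b * q a) ∂ν ∂ν) ^ Fintype.card ι
      ≤ ∫ x, ∫ x', min ((∏ i : ι, p (x i)) * ∏ i, q (x' i)) ((∏ i, p (x' i)) * ∏ i, q (x i))
          ∂(Measure.pi fun _ : ι => ν) ∂(Measure.pi fun _ : ι => ν) := by
  have h := prod_meanAccept_le_meanAccept_pi (ι := ι) (μ := fun _ : ι => ν) (p := fun _ => p)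
    (q := fun _ => q) (fun _ => hp0) (fun _ => hpm) (fun _ => hpi) (fun _ => hq0) (fun _ => hqm)
    fun _ => hqi
  rwa [prod_const, card_univ] at h

/-- **Identical blocks, ESS**: `ESS(p^{⊗m}, q^{⊗m}) = ESS(p, q)^m`, `m = card ι`. [ours] -/
theorem essFrac_pi_const (p q : Y → ℝ) :
    (∫ x, ∏ i : ι, p (x i) ∂(Measure.pi fun _ : ι => ν)) ^ 2
        / ∫ x, (∏ i : ι, p (x i)) ^ 2 / ∏ i, q (x i) ∂(Measure.pi fun _ : ι => ν)
      = ((∫ a, p a ∂ν) ^ 2 / ∫ a, p a ^ 2 / q a ∂ν) ^ Fintype.card ι := by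
  rw [essFrac_pi (ι := ι) (X := fun _ => Y) (μ := fun _ : ι => ν) (fun _ => p) (fun _ => q),
    prod_const, card_univ]

end Const

end Summit.Ventures.LatticeQCDFlow.Theory2
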